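import Mathlib
import HarnessLib
import Summits.ValiantsHypothesis.ValiantsHypothesis.Theses.MonotoneRestoration
import Literature.Computability.AlgebraicComplexity.ArithCircuit
import Literature.Computability.AlgebraicComplexity.ArithCircuitProofs
import Literature.Computability.AlgebraicComplexity.MonotoneStructure
import Literature.Computability.AlgebraicComplexity.PermanentIrreducible
import Literature.ModelTheory.FiniteModelTheory.CkEquiv
import Summits.ValiantsHypothesis.ValiantsHypothesis.Theorems.MonotoneRestorationMonotoneRestorationQPCosetCount
import Summits.ValiantsHypothesis.ValiantsHypothesis.Theorems.MonotoneRestorationMonotoneRestorationQPSymmetricLB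
import Summits.ValiantsHypothesis.ValiantsHypothesis.Theorems.MonotoneRestorationMonotoneRestorationQPSupportSymmetrisation
import Summits.ValiantsHypothesis.ValiantsHypothesis.Theorems.MonotoneRestorationMonotoneRestorationQPSparseRegime
import Summits.ValiantsHypothesis.ValiantsHypothesis.Theorems.MonotoneRestorationMonotoneRestorationQPBeta
import Literature.Computability.AlgebraicComplexity.SymmetricArithCircuit
import Literature.Computability.AlgebraicComplexity.DawarWilsenach2025Proofs
import Literature.GroupTheory.PermutationGroups.SmallIndexSubgroups
import Summits.ValiantsHypothesis.ValiantsHypothesis.Theorems.MonotoneRestorationQP.Negative.LoadBearing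
import Summits.ValiantsHypothesis.ValiantsHypothesis.Theorems.MonotoneRestorationMonotoneRestorationQPPermSupportCount
import Literature.Computability.AlgebraicComplexity.CircuitGateSemantics
import Summits.ValiantsHypothesis.ValiantsHypothesis.Theorems.MonotoneRestorationMonotoneRestorationQPGamma

/-! TTRL-lite variant V20132 of stmt-ValiantsHypothesis-15886

# The CANCELLATION-FREE support reduction is FALSE (variant V20132, negative side)

Variant V20132 (move `generalise`) of stub `stub_monotoneSupportReduction` of crux
`MonotoneRestorationQP` asks that every matrix-symmetric family over `ℝ≥0` of polynomial degree
and polynomial monotone complexity be computed by a quasi-polynomial straight-line program OVER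
`ℝ≥0` (an `ArithCircuit ℝ≥0`) annotated with supports `K i` of polylogarithmic size: product
gates take only operands supported inside `K i`, the value of gate `i` is invariant under the
pointwise stabiliser of `K i` (diagonal action), and the output gate has empty support.

This is false, and for a reason that needs no size bound at all
(`var20132_supportedMonotoneProgram_false`): over `ℝ≥0` NO support-annotated program with all
supports of size `≤ κ` computes a nonzero homogeneous row-multilinear polynomial of degree
`d ≥ 2κ + 2`. The proof is the "used & big" descent of Theorem γ
(`stub_symmetricMonotone_choose_le_card`, file `…QPChooseLeCard.lean`) run directly on the
program: call gate `i` *used* if its monomials extend uniformly into the support of the output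
(`∃ μ, ∀ m ∈ supp (val i), m + μ ∈ supp f`) and *big* if one of its monomials touches a row
outside `K i`. For a used big gate the rows of `μ` lie in `K i` (swap the touched row with a
row of `μ` outside `K i`: the swap fixes `K i` pointwise, so the swapped monomial is again a
monomial of gate `i`, and adding `μ` would square a row of the row-multilinear `f`), hence every
monomial of gate `i` has `≥ d - κ ≥ κ + 2` rows and escapes every `K j`. So gate `i` is not fed
the big monomial by a variable or a constant; at a `+` gate the operand carrying it is a used
big gate `j < i` (no cancellation over `ℝ≥0`); at a `×` gate the operand carrying the outside
row is a gate `j < i` with `K j ⊆ K i` (the support discipline of product gates — this replaces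
the `Alt`-orbit dichotomy G2 of γ), big by that inclusion and used because over `ℝ≥0` the
monomials of the other factors multiply every monomial of gate `j` into gate `i` (G3). Strong
induction on `i`: no gate is used and big; but the output gate (support `∅`, value `f ≠ 0` of
degree `d ≥ 2`) is. The witness family is Theorem γ's `e_{⌊n/2⌋}` of the row sums
(`stub_esymmRowSums_structure`, `stub_esymmRowSums_complexity`), at the large `n` of
`stub_gammaArithmetic`.
-/

-- `ValiantsHypothesis.ValiantsHypothesis`: the D-0017 layout repeats the problem name in the path.
set_option linter.dupNamespace false

namespace Summit.ValiantsHypothesis.ValiantsHypothesis.Theorems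

open Summit.ValiantsHypothesis.ValiantsHypothesis.Theses.MonotoneRestoration
open Literature.Computability.AlgebraicComplexity
open MvPolynomial
open scoped NNReal

/-- **No support-annotated monotone program computes a row-multilinear form of degree
`≥ 2κ + 2` with supports of size `≤ κ`.** Let `f ≠ 0` over `ℝ≥0` be homogeneous of degree `d`
and row-multilinear, `2κ + 2 ≤ d`. There is no straight-line program `P` over `ℝ≥0` with a
support annotation `K` (`|K i| ≤ κ`; operands of product gates supported inside `K i`; the value
of gate `i < size` invariant under every permutation fixing `K i` pointwise, acting diagonally;
output a gate of empty support) computing `f` — whatever its size. Proof: the used/big descent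
of Theorem γ run on the program (see the module docstring). [new] -/
theorem var20132_supportedMonotoneProgram_false {n κ d : ℕ}
    (f : MvPolynomial (Fin n × Fin n) ℝ≥0) (hhom : f.IsHomogeneous d) (h0 : f ≠ 0)
    (hrow : ∀ m ∈ f.support, ∀ i : Fin n, rowDegrees m i ≤ 1) (hd : 2 * κ + 2 ≤ d)
    (P : ArithCircuit ℝ≥0 (Fin n × Fin n)) (K : ℕ → Finset (Fin n))
    (hk : ∀ i, (K i).card ≤ κ)
    (hprod : ∀ (i : ℕ) (us : List (ArithCircuit.Operand ℝ≥0 (Fin n × Fin n))),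
      P.gates[i]? = some (ArithCircuit.Gate.prod us) → ∀ u ∈ us, SupportSymm.osupp K u ⊆ K i)
    (hinv : ∀ (i : ℕ) (σ : Equiv.Perm (Fin n)), i < P.size → (∀ x ∈ K i, σ x = x) →
      MvPolynomial.rename (fun pq : Fin n × Fin n => (σ pq.1, σ pq.2))
        ((ArithCircuit.gateValues P.gates).getD i 0) = (ArithCircuit.gateValues P.gates).getD i 0)
    (hout : ∃ j, P.output = ArithCircuit.Operand.gate j ∧ j < P.size ∧ K j = ∅)
    (heval : P.eval = f) : False := by
  classical
  -- the invariance hypothesis, in terms of `gateVal`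
  have hinv' : ∀ (i : ℕ) (σ : Equiv.Perm (Fin n)), i < P.size → (∀ x ∈ K i, σ x = x) →
      MvPolynomial.rename (fun pq : Fin n × Fin n => (σ pq.1, σ pq.2)) (P.gateVal i) =
        P.gateVal i := hinv
  -- monomials of `f` have degree `d`
  have hdegf : ∀ M ∈ f.support, M.degree = d := by
    intro M hM
    rw [Finsupp.degree_apply]
    exact (hhom.degree_eq_sum_deg_support hM).symm
  -- renamed monomials stay in the support of an invariant polynomial
  have hren : ∀ (q : MvPolynomial (Fin n × Fin n) ℝ≥0) (ρ : Equiv.Perm (Fin n))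
      (m : Fin n × Fin n →₀ ℕ),
      MvPolynomial.rename (fun p : Fin n × Fin n => (ρ p.1, ρ p.2)) q = q →
      m ∈ q.support →
      Finsupp.mapDomain (fun p : Fin n × Fin n => (ρ p.1, ρ p.2)) m ∈ q.support := by
    intro q ρ m hq hm
    rw [← hq, mem_support_iff, coeff_rename_mapDomain _ (gamma_diag_injective ρ)]
    exact mem_support_iff.1 hm
  have hrenrow : ∀ (ρ : Equiv.Perm (Fin n)) (m : Fin n × Fin n →₀ ℕ) (i : Fin n),
      rowDegrees (Finsupp.mapDomain (fun p : Fin n × Fin n => (ρ p.1, ρ p.2)) m) (ρ i) =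
        rowDegrees m i := by
    intro ρ m i
    rw [gamma_rowDegrees_mapDomain, Finsupp.mapDomain_apply ρ.injective]
  -- MAIN CLAIM: no gate is used and big
  have key : ∀ i : ℕ,
      (∃ μ : Fin n × Fin n →₀ ℕ, ∀ m ∈ (P.gateVal i).support, m + μ ∈ f.support) →
      (∃ m ∈ (P.gateVal i).support, ∃ r ∉ K i, rowDegrees m r ≠ 0) → False := by
    intro i
    induction i using Nat.strong_induction_on with
    | _ i ih =>
    rintro ⟨μ, hμ⟩ ⟨m₁, hm₁, r₁, hr₁, hmr₁⟩
    -- the gate is a genuine gate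
    have hi : i < P.size := by
      by_contra hle
      rw [P.gateVal_of_le (not_lt.1 hle), support_zero] at hm₁
      exact Finset.notMem_empty _ hm₁
    -- Step A: the rows of the context `μ` lie in `K i`
    have hrowsμ : ∀ r, rowDegrees μ r ≠ 0 → r ∈ K i := by
      intro r hr
      by_contra hrK
      have hρK : ∀ x ∈ K i, Equiv.swap r₁ r x = x := fun x hx =>
        Equiv.swap_apply_of_ne_of_ne (fun h => hr₁ (h ▸ hx)) (fun h => hrK (h ▸ hx))
      have hm' := hren _ (Equiv.swap r₁ r) m₁ (hinv' i _ hi hρK) hm₁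
      have h1 := hrow _ (hμ _ hm') r
      rw [rowDegrees_add, Finsupp.add_apply] at h1
      have h2 := hrenrow (Equiv.swap r₁ r) m₁ r₁
      rw [Equiv.swap_apply_left] at h2
      rw [h2] at h1
      omega
    have hμrow : ∀ r, rowDegrees μ r ≤ 1 := by
      intro r
      have h1 := hrow (m₁ + μ) (hμ m₁ hm₁) r
      rw [rowDegrees_add, Finsupp.add_apply] at h1
      omega
    have hμdeg : μ.degree ≤ κ := by
      rw [gamma_degree_eq_card_rows hμrow]
      calc (rowDegrees μ).support.card ≤ (K i).card :=
            Finset.card_le_card fun r hr => hrowsμ r (Finsupp.mem_support_iff.1 hr)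
        _ ≤ κ := hk i
    -- every monomial of gate `i` is row-multilinear of degree `d - deg μ ≥ κ + 2`
    have hmdeg : ∀ m ∈ (P.gateVal i).support, m.degree + μ.degree = d := by
      intro m hm
      rw [← map_add]
      exact hdegf _ (hμ m hm)
    have hmrow : ∀ m ∈ (P.gateVal i).support, ∀ r, rowDegrees m r ≤ 1 := by
      intro m hm r
      have h1 := hrow (m + μ) (hμ m hm) r
      rw [rowDegrees_add, Finsupp.add_apply] at h1
      omega
    have hescape : ∀ m ∈ (P.gateVal i).support, ∀ Y : Finset (Fin n), Y.card ≤ κ →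
        ∃ r ∉ Y, rowDegrees m r ≠ 0 := by
      intro m hm Y hY
      have hcard : Y.card < (rowDegrees m).support.card := by
        rw [← gamma_degree_eq_card_rows (hmrow m hm)]; have := hmdeg m hm; omega
      obtain ⟨r, hr, hrY⟩ := Finset.exists_mem_notMem_of_card_lt_card hcard
      exact ⟨r, hrY, Finsupp.mem_support_iff.1 hr⟩
    have hdeg2 : ∀ m ∈ (P.gateVal i).support, 2 ≤ m.degree := fun m hm => by
      have := hmdeg m hm; omega
    -- case analysis on the gate
    obtain ⟨g, hg⟩ : ∃ g, P.gates[i]? = some g :=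
      ⟨P.gates[i]'hi, List.getElem?_eq_getElem (show i < P.gates.length from hi)⟩
    cases g with
    | sum args =>
      -- a `+` gate: the operand carrying `m₁` is a used big gate
      have hev : P.gateVal i =
          ∑ t : Fin args.length, (args[t.1]).1 • P.opVal i (args[t.1]).2 := by
        rw [P.gateVal_of_sum hg, ← Fin.sum_univ_fun_getElem]
      have hm₁' := hm₁
      rw [hev] at hm₁'
      obtain ⟨t, -, hmt⟩ := Finset.mem_biUnion.1 (support_sum hm₁')
      have hc : (args[t.1]).1 ≠ 0 := by
        intro hc
        rw [hc, zero_smul, support_zero] at hmt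
        exact Finset.notMem_empty _ hmt
      have hmt' : m₁ ∈ (P.opVal i (args[t.1]).2).support := support_smul hmt
      -- no cancellation: the operand's monomials are monomials of gate `i`
      have hsubsupp : ∀ m ∈ (P.opVal i (args[t.1]).2).support, m ∈ (P.gateVal i).support := by
        intro m hm
        have hm' : coeff m ((args[t.1]).1 • P.opVal i (args[t.1]).2) ≠ 0 := by
          rw [coeff_smul, smul_eq_mul]
          exact mul_ne_zero hc (mem_support_iff.1 hm)
        rw [mem_support_iff, hev]
        intro h0
        have hle := coeff_le_coeff_sum Finset.univ
          (fun s : Fin args.length => (args[s.1]).1 • P.opVal i (args[s.1]).2)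
          (Finset.mem_univ t) m
        rw [h0, nonpos_iff_eq_zero] at hle
        exact hm' hle
      generalize hu : (args[t.1]).2 = u at hmt' hsubsupp
      cases u with
      | var pq =>
        rw [ArithCircuit.opVal_var, support_X, Finset.mem_singleton] at hmt'
        have h1 := hdeg2 m₁ hm₁
        rw [hmt', Finsupp.degree_single] at h1
        omega
      | const c =>
        rw [ArithCircuit.opVal_const, mem_support_iff, coeff_C] at hmt'
        have hm0 : m₁ = 0 := by
          by_contra hne
          rw [if_neg (Ne.symm hne)] at hmt'
          exact hmt' rfl
        rw [hm0, rowDegrees_zero, Finsupp.zero_apply] at hmr₁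
        exact hmr₁ rfl
      | gate j =>
        rw [ArithCircuit.opVal_gate] at hmt' hsubsupp
        by_cases hji : j < i
        · rw [if_pos hji] at hmt' hsubsupp
          obtain ⟨r, hr, hmr⟩ := hescape m₁ hm₁ (K j) (hk j)
          exact ih j hji ⟨μ, fun m hm => hμ m (hsubsupp m hm)⟩ ⟨m₁, hmt', r, hr, hmr⟩
        · rw [if_neg hji, support_zero] at hmt'
          exact Finset.notMem_empty _ hmt'
    | prod us =>
      -- a `×` gate: the operand carrying the row `r₁` is a used big gate
      have hev : P.gateVal i = ∏ t : Fin us.length, P.opVal i (us[t.1]) := by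
        rw [P.gateVal_of_prod hg, ← Fin.prod_univ_fun_getElem]
      have hm₁' := hm₁
      rw [hev] at hm₁'
      obtain ⟨ν, hν, hm₁eq⟩ :=
        gamma_mem_support_prod Finset.univ (fun t : Fin us.length => P.opVal i (us[t.1])) hm₁'
      have hsumrow : rowDegrees m₁ r₁ = ∑ t ∈ (Finset.univ : Finset (Fin us.length)),
          rowDegrees (ν t) r₁ := by
        rw [hm₁eq, rowDegrees, Finsupp.mapDomain_finsetSum, Finsupp.finsetSum_apply]
        rfl
      obtain ⟨t₀, -, hνr₁⟩ : ∃ t₀ ∈ (Finset.univ : Finset (Fin us.length)),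
          rowDegrees (ν t₀) r₁ ≠ 0 := by
        by_contra hcon
        push Not at hcon
        exact hmr₁ (by rw [hsumrow]; exact Finset.sum_eq_zero hcon)
      have hu : us[t₀.1] ∈ us := List.getElem_mem t₀.2
      have hsub := hprod i us hg _ hu
      have hνt₀ := hν t₀ (Finset.mem_univ _)
      -- G3: the operand is used, with context the other factors' monomials plus `μ`
      have hused : ∀ m ∈ (P.opVal i (us[t₀.1])).support,
          m + ((∑ t ∈ Finset.univ \ {t₀}, ν t) + μ) ∈ f.support := by
        intro m hm
        rw [← add_assoc]
        apply hμ
        rw [hev]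
        have key := gamma_sum_mem_support_prod Finset.univ
          (fun t : Fin us.length => P.opVal i (us[t.1])) (ν := Function.update ν t₀ m)
          (fun t _ => by
            rcases eq_or_ne t t₀ with rfl | hne
            · rw [Function.update_self]; exact hm
            · rw [Function.update_of_ne hne]; exact hν t (Finset.mem_univ t))
        rwa [Finset.sum_update_of_mem (Finset.mem_univ t₀)] at key
      generalize hu₀ : us[t₀.1] = u at hsub hνt₀ hused
      cases u with
      | var pq =>
        rw [ArithCircuit.opVal_var, support_X, Finset.mem_singleton] at hνt₀
        rw [hνt₀, rowDegrees_single, Finsupp.single_apply] at hνr₁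
        have hpq : pq.1 = r₁ := by
          by_contra h
          exact hνr₁ (if_neg h)
        refine hr₁ (hsub ?_)
        simp [SupportSymm.osupp, hpq]
      | const c =>
        rw [ArithCircuit.opVal_const, mem_support_iff, coeff_C] at hνt₀
        have h00 : ν t₀ = 0 := by
          by_contra hne
          rw [if_neg (Ne.symm hne)] at hνt₀
          exact hνt₀ rfl
        rw [h00, rowDegrees_zero, Finsupp.zero_apply] at hνr₁
        exact hνr₁ rfl
      | gate j =>
        rw [ArithCircuit.opVal_gate] at hνt₀ hused
        by_cases hji : j < i
        · rw [if_pos hji] at hνt₀ hused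
          have hKj : K j ⊆ K i := fun x hx => hsub (by simpa [SupportSymm.osupp] using hx)
          exact ih j hji ⟨_, hused⟩ ⟨ν t₀, hνt₀, r₁, fun h => hr₁ (hKj h), hνr₁⟩
        · rw [if_neg hji, support_zero] at hνt₀
          exact Finset.notMem_empty _ hνt₀
  -- the output gate is used (context `0`) and big (its monomials have `d ≥ 2 > 0 = |∅|` rows)
  obtain ⟨j, hPo, hj, hKj⟩ := hout
  have hVj : P.gateVal j = f := by
    rw [← heval, P.eval_eq_opVal_output, hPo, ArithCircuit.opVal_gate, if_pos hj]
  obtain ⟨m, hm⟩ := support_nonempty.2 h0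
  have hcard : (K j).card < (rowDegrees m).support.card := by
    rw [hKj, Finset.card_empty, ← gamma_degree_eq_card_rows (hrow m hm), hdegf m hm]
    omega
  obtain ⟨r, hr, hrK⟩ := Finset.exists_mem_notMem_of_card_lt_card hcard
  refine key j ⟨0, fun m' hm' => ?_⟩ ⟨m, by rwa [hVj], r, hrK, Finsupp.mem_support_iff.1 hr⟩
  rw [add_zero]
  rwa [hVj] at hm'

/-- **Variant V20132 of `stub_monotoneSupportReduction` is FALSE.** The cancellation-free
support reduction (a quasi-polynomial support-annotated program OVER `ℝ≥0` with polylog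
supports computing `f n` itself) fails for `f n = e_{⌊n/2⌋}(R₁, …, R_n)`, `R_i = Σ_j x_ij`: the
family is matrix-symmetric, of degree `⌊n/2⌋` and monotone complexity `≤ (n+2)^{c₀}`
(`stub_esymmRowSums_structure`, `stub_esymmRowSums_complexity`), and at the large `n` of
`stub_gammaArithmetic` (`((log₂ n + c)^c + 2)² ≤ n/2`, so `2 (log₂ n + c)^c + 2 ≤ n/2`) the
promised program is excluded by `var20132_supportedMonotoneProgram_false` (no size bound is
even needed). [new] -/
theorem stub_monotoneSupportReduction_var20132_false : ¬ (∀ f : (n : ℕ) → MvPolynomial (Fin n × Fin n) NNReal, (∀ (n : ℕ) (σ τ : Equiv.Perm (Fin n)), MvPolynomial.rename (fun p : Fin n × Fin n => (σ p.1, τ p.2)) (f n) = f n) → (∃ c : ℕ, ∀ n : ℕ, (f n).totalDegree ≤ (n + 2) ^ c ∧ complexity (k := NNReal) (f n) ≤ (n + 2) ^ c) → ∃ c : ℕ, ∀ n : ℕ, ∃ (P : ArithCircuit NNReal (Fin n × Fin n)) (K : ℕ → Finset (Fin n)), (∀ g ∈ P.gates, g.args ≠ []) ∧ (∀ g ∈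 P.gates, g.fanIn ≤ 2 ^ ((Nat.log 2 n + c) ^ c)) ∧ P.WellFormed ∧ (∀ i, (K i).card ≤ (Nat.log 2 n + c) ^ c) ∧ (∀ (i : ℕ) (us : List (ArithCircuit.Operand NNReal (Fin n × Fin n))), P.gates[i]? = some (ArithCircuit.Gate.prod us) → ∀ u ∈ us, SupportSymm.osupp K u ⊆ K i) ∧ (∀ (i : ℕ) (σ : Equiv.Perm (Fin n)), i < P.size → (∀ x ∈ K i, σ x = x) → MvPolynomial.rename (fun pq : Fin n × Fin n => (σ pq.1, σ pq.2)) ((ArithCircuit.gateValues P.gates).getD i 0) = (ArithCircuit.gateValues P.gates).getD i 0) ∧ (∃ j, P.output = ArithCircuit.Operand.gate j ∧ j < P.size ∧ K j = ∅) ∧ P.size ≤ 2 ^ ((Nat.log 2 n + c) ^ c) ∧ P.eval = f n) := by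
  intro h
  obtain ⟨c₀, hc₀⟩ := stub_esymmRowSums_complexity
  have hpoly : ∃ c : ℕ, ∀ n : ℕ,
      (MvPolynomial.bind₁ (fun i : Fin n => ∑ j : Fin n, MvPolynomial.X (i, j))
          (MvPolynomial.esymm (Fin n) NNReal (n / 2))).totalDegree ≤ (n + 2) ^ c ∧
        complexity (k := NNReal) (MvPolynomial.bind₁
          (fun i : Fin n => ∑ j : Fin n, MvPolynomial.X (i, j))
          (MvPolynomial.esymm (Fin n) NNReal (n / 2))) ≤ (n + 2) ^ c := by
    refine ⟨c₀ + 1, fun n => ⟨?_, ?_⟩⟩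
    · calc (MvPolynomial.bind₁ (fun i : Fin n => ∑ j : Fin n, MvPolynomial.X (i, j))
              (MvPolynomial.esymm (Fin n) NNReal (n / 2))).totalDegree ≤ n / 2 :=
            (stub_esymmRowSums_structure n).1.totalDegree_le
        _ ≤ n + 2 := by omega
        _ ≤ (n + 2) ^ (c₀ + 1) := by
            calc n + 2 = (n + 2) ^ 1 := (pow_one _).symm
              _ ≤ (n + 2) ^ (c₀ + 1) := Nat.pow_le_pow_right (by omega) (by omega)
    · exact (hc₀ n).trans (Nat.pow_le_pow_right (by omega) (by omega))
  obtain ⟨c, hc⟩ := h (fun n => MvPolynomial.bind₁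
      (fun i : Fin n => ∑ j : Fin n, MvPolynomial.X (i, j))
      (MvPolynomial.esymm (Fin n) NNReal (n / 2)))
    (fun n σ τ => (stub_esymmRowSums_structure n).2.2.2 σ τ) hpoly
  obtain ⟨N, hN⟩ := stub_gammaArithmetic c
  obtain ⟨-, -, hkk, -, -⟩ := hN N le_rfl
  obtain ⟨P, K, -, -, -, hk, hprod, hinv, hout, -, heval⟩ := hc N
  obtain ⟨hhom, hrow, h0, -⟩ := stub_esymmRowSums_structure N
  have hd : 2 * ((Nat.log 2 N + c) ^ c) + 2 ≤ N / 2 := by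
    generalize (Nat.log 2 N + c) ^ c = M at hkk ⊢
    have h1 : 2 * (M + 2) ≤ (M + 2) * (M + 2) := Nat.mul_le_mul_right _ (by omega)
    have h2 : 2 * M + 2 ≤ 2 * (M + 2) := by omega
    exact h2.trans (h1.trans hkk)
  exact var20132_supportedMonotoneProgram_false _ hhom h0 hrow hd P K hk hprod hinv hout heval

end Summit.ValiantsHypothesis.ValiantsHypothesis.Theorems
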